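import Summits.QuantumFields.YangMills.Theorems.FluctuationComparisonRegPrIntLS2BetaTransversalShift
import Mathlib.Analysis.SpecificLimits.Normed
import HarnessLib

/-!
# LINE g18-1 S2β LAPLACE — (T2-SHIFT UNIFORM) OFF-PIVOT QUADRATIC TRANSVERSALITY AT A SHIFTED BASE POINT WITH ONE CONSTANT FOR ALL BASE POINTS
# (w4-20520 g16's ask for v11.1: `∃ c₁ > 0, ∀ y₁, (∀ b, ‖(eV y₁)_b‖ ≤ 1∕2) → ∀ᶠ v in 𝓝 0, c₁‖v‖² ≤ ⨅_w Σ_{ℓ ∉ piv} dist1 (σ (y₁+v) ℓ · ((w • σ y₁) ℓ)⁻¹)²`)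

Crux `stmt-QuantumFields-20520` (`…Theses.UnitScaleTilt.FluctuationComparisonRegPrIntL`); cell `ym3-torus` (HUMAN RULING D-0037 — YM₃ on T³ is ladder rung
R3, not the Clay problem), width seat `ym3-torus-px21` g11; count-neutral helper (`--kind proof --supports stmt-QuantumFields-20520 --as helper`).
Theorems only: 0 `def`, 0 `instance`, 0 `notation`, 0 `sorry`.

WHY.  ✓`…TransversalShift.offPivot_transversal_shift` (p748520) gives, at EACH base point `y₁`, a constant `c₁(y₁) > 0`; v11.1's edge supplier
✓`detRepA_edge` binds ONE `c₁` for the whole edge (w4-20520 g16, 23:14:38Z).  The constant IS uniform: the quantifier swap costs nothing but bookkeeping, because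
(§0) the derivative `g(ad X)` of `Y ↦ e^{−X}e^{Y}` at `X` has an inverse of norm `≤ B := ‖1‖ − 1 + (1 − (e−1)∕2)⁻¹` for EVERY `‖X‖ ≤ 1∕2` (`‖1 − g(ad X)‖ ≤ (e^{‖ad X‖} − 1)∕2 ≤
(e−1)∕2 < 1`, lit ✓`norm_gSer_sub_one_le`, ✓`norm_ad_le`; Neumann series, Mathlib `tsum_geometric_le_of_norm_lt_one`), so `c = 1∕(2(B+1))` serves all base points
(only the little-o neighbourhood of `exp` depends on `X`); (§1) the framed square-sum constant is then `c²∕(‖eV⁻¹‖² + 1)`; (§2) px21 g10's (T2) step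
✓`offPivot_transversal_of_rows` has `c₁ = c∕(C+1)` with `C` from ✓`exists_sum_dist1_coord_le_offPivot` (lattice data only) — re-quantified here as
`offPivot_transversal_of_rows_uniform`.  Result ★★`offPivot_transversal_shift_uniform`, token shape as asked.
HONEST: a quantifier swap over ✓p748520's argument; proves no stub; GROWTH's GAP♯ half, DET-REP-A∕B, LAPLACE, S2β, crux 20520 NOT proved; rung R3 — NOT d = 4, NOT
infinite volume, NOT a mass gap, NOT Clay.
[cite: Helgason2000, Ch. I §1 Thm 1.14 (12)-(13) p.96; Balaban1985Averaging, (33)-(34) pp.22-23; Balaban1985Variational, Thm 1 (10) p.279, (19) p.281; Hall2015, Thm 5.4]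
-/

noncomputable section

open MeasureTheory MeasureTheory.Measure Filter Topology Set Function NormedSpace
open scoped ENNReal Matrix.Norms.L2Operator Nat
open Literature.MathematicalPhysics.QuantumFieldTheory.Balaban1983to89
open Literature.MathematicalPhysics.QuantumFieldTheory.Balaban1983to89.HaarExponentialChart
open Literature.MathematicalPhysics.QuantumFieldTheory.Balaban1983to89.LogChartProduct
open Literature.MathematicalPhysics.QuantumFieldTheory.Balaban1983to89.T3ContinuumYM3Torus
open Literature.MathematicalPhysics.QuantumFieldTheory.Balaban1983to89.T3TiltDescent
open Literature.MathematicalPhysics.QuantumFieldTheory.Balaban1983to89.T3UnitLawDensityEML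
open scoped Literature.MathematicalPhysics.QuantumFieldTheory.Balaban1983to89.T3OrbitAverage
open Literature.MathematicalPhysics.QuantumFieldTheory.Balaban1983to89.B12GaugeOrbits021 (IsResidual)
open Literature.MathematicalPhysics.QuantumFieldTheory.Balaban1983to89.B13HaarSigmaJacobian (hasFDerivAt_exp_neg_mul_exp)
open Literature.Analysis.Calculus.ExpDifferential
open Summit.QuantumFields.YangMills.Theorems.FluctuationComparisonRegPrIntLWregChain (iterCentralBond)
open Summit.QuantumFields.YangMills.Theorems.FluctuationComparisonRegPrIntLS2BetaSignedComb (combTransporter)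
open Summit.QuantumFields.YangMills.Theorems.FluctuationComparisonRegPrIntLS2BetaSignedCombKill (combSet)
open Summit.QuantumFields.YangMills.Theorems.FluctuationComparisonRegPrIntLS2BetaSignedCombLipschitz
open Summit.QuantumFields.YangMills.Theorems.FluctuationComparisonRegPrIntLS2BetaResidualGauge (residual_one)
open Summit.QuantumFields.YangMills.Theorems.FluctuationComparisonRegPrIntLS2BetaResidualGaugeCentral (exists_central_isResidual_of_residual)

namespace Summit.QuantumFields.YangMills.Theorems.FluctuationComparisonRegPrIntLS2BetaTransversalShiftUniform

/-! ## §0  One constant for all small base points: `‖e^{−X}e^{Y} − 1‖ ≥ c·‖Y − X‖` near every `X` with `‖X‖ ≤ 1∕2` -/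

section ExpBase

variable {𝔸 : Type*} [NormedRing 𝔸] [CompleteSpace 𝔸]

/-- ★ **UNIFORM LOWER BOUND**: `∃ c > 0, ∀ X, ‖X‖ ≤ 1∕2 → ∀ᶠ Y in 𝓝 X, c·‖Y − X‖ ≤ ‖e^{−X}e^{Y} − 1‖` — one constant for ALL small base points
(`c = 1∕(2(B+1))`, `B = ‖1‖ − 1 + (1 − (e−1)∕2)⁻¹` a bound on `‖g(ad X)⁻¹‖` from the Neumann series; only the neighbourhood depends on `X`).
[cite: Balaban1985Averaging, (33)-(34) pp.22-23; Hall2015, Thm 5.4] -/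
theorem exists_const_norm_sub_le_norm_exp_neg_mul_exp_sub_one (𝕂 : Type*) [RCLike 𝕂] [NormedAlgebra 𝕂 𝔸] :
    ∃ c : ℝ, 0 < c ∧ ∀ X : 𝔸, ‖X‖ ≤ 1 / 2 → ∀ᶠ Y in 𝓝 X, c * ‖Y - X‖ ≤ ‖exp (-X) * exp Y - 1‖ := by
  -- the uniform bound on the inverse of `g(ad X)`
  set ρ : ℝ := (Real.exp 1 - 1) / 2 with hρ
  have hρ1 : ρ < 1 := by have := Real.exp_one_lt_d9; rw [hρ]; linarith
  have hρ0 : 0 ≤ ρ := by have := Real.add_one_le_exp (1 : ℝ); rw [hρ]; linarith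
  set B : ℝ := ‖(1 : 𝔸 →L[𝕂] 𝔸)‖ - 1 + (1 - ρ)⁻¹ with hB
  have hB0 : 0 ≤ B := by
    have h1 : (1 : ℝ) ≤ (1 - ρ)⁻¹ := one_le_inv_iff₀.2 ⟨by linarith, by linarith⟩
    have h2 : 0 ≤ ‖(1 : 𝔸 →L[𝕂] 𝔸)‖ := norm_nonneg _
    rw [hB]; linarith
  refine ⟨1 / (2 * (B + 1)), by positivity, ?_⟩
  intro X hX
  have hL1 : ‖ad 𝕂 X‖ ≤ 1 := (norm_ad_le (𝕂 := 𝕂) X).trans (by linarith)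
  -- `A := 1 − g(ad X)`, `‖A‖ ≤ ρ < 1`, `G := Σ Aⁿ`, `G · g(ad X) = 1`, `‖G‖ ≤ B`
  set L : 𝔸 →L[𝕂] 𝔸 := gSer 𝕂 (ad 𝕂 X) with hL
  set A : 𝔸 →L[𝕂] 𝔸 := 1 - L with hA
  have hAρ : ‖A‖ ≤ ρ := by
    rw [hA, norm_sub_rev]
    refine (norm_gSer_sub_one_le (𝕂 := 𝕂) (ad 𝕂 X)).trans ?_
    rw [hρ]
    have := Real.exp_le_exp.2 hL1
    linarith
  have hA1 : ‖A‖ < 1 := lt_of_le_of_lt hAρ hρ1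
  set G : 𝔸 →L[𝕂] 𝔸 := ∑' n : ℕ, A ^ n with hG
  have hGL : ∀ V, G (L V) = V := by
    intro V
    have h1 : G * (1 - A) = 1 := geom_series_mul_neg A hA1
    have h2 : (1 : 𝔸 →L[𝕂] 𝔸) - A = L := by rw [hA]; abel
    rw [h2] at h1
    have h3 := congrArg (fun T : 𝔸 →L[𝕂] 𝔸 => T V) h1
    simpa only [mul_apply_eq_comp, one_apply_eq_self] using h3
  have hGB : ‖G‖ ≤ B := by
    refine (tsum_geometric_le_of_norm_lt_one A hA1).trans ?_
    rw [hB]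
    have : (1 - ‖A‖)⁻¹ ≤ (1 - ρ)⁻¹ := by
      apply inv_anti₀ (by linarith) (by linarith)
    linarith
  have hlow : ∀ V, ‖V‖ ≤ (B + 1) * ‖L V‖ := by
    intro V
    calc ‖V‖ = ‖G (L V)‖ := by rw [hGL]
      _ ≤ ‖G‖ * ‖L V‖ := G.le_opNorm _
      _ ≤ (B + 1) * ‖L V‖ := by gcongr; linarith
  have ha : 0 < B + 1 := by linarith
  have hε : (0 : ℝ) < 1 / (2 * (B + 1)) := by positivity
  have hev := (hasFDerivAt_exp_neg_mul_exp (𝕂 := 𝕂) X).isLittleO.def hε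
  filter_upwards [hev] with Y hY
  rw [exp_neg_mul_exp_eq_one (𝕂 := 𝕂) X] at hY
  have h1 : ‖L (Y - X)‖ ≤ ‖exp (-X) * exp Y - 1‖ + ‖exp (-X) * exp Y - 1 - L (Y - X)‖ := by
    calc ‖L (Y - X)‖ = ‖(exp (-X) * exp Y - 1) - (exp (-X) * exp Y - 1 - L (Y - X))‖ := by congr 1; abel
      _ ≤ ‖exp (-X) * exp Y - 1‖ + ‖exp (-X) * exp Y - 1 - L (Y - X)‖ := norm_sub_le _ _
  have h2 := hlow (Y - X)
  have h3 : ‖Y - X‖ / (B + 1) ≤ ‖L (Y - X)‖ := by rw [div_le_iff₀ ha]; linarith [h2]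
  have h4 : (1 / (2 * (B + 1))) * ‖Y - X‖ = ‖Y - X‖ / (B + 1) - (1 / (2 * (B + 1))) * ‖Y - X‖ := by
    field_simp; ring
  have hY' : ‖exp (-X) * exp Y - 1 - L (Y - X)‖ ≤ 1 / (2 * (B + 1)) * ‖Y - X‖ := hY
  linarith [h1, hY', h3, h4]

end ExpBase

/-! ## §1  The framed square-sum form, one constant for all small base points -/

section Frame

variable {𝔸 : Type*} [NormedRing 𝔸] [NormedAlgebra ℂ 𝔸] [CompleteSpace 𝔸]
variable (C : LogChart 𝔸) {B : Type*} [Fintype B]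
variable {V : Type*} [NormedAddCommGroup V] [NormedSpace ℝ V]

/-- ★ **UNIFORM FRAMED SQUARE-SUM LOWER BOUND**: for a frame `eV : V ≃ 𝔤^B` there is ONE `c > 0` such that for EVERY base point `y₁` with
`‖(eV y₁)_b‖ ≤ 1∕2` on every `b`: `c‖v‖² ≤ Σ_b ‖exp(−(eV y₁)_b)·exp((eV (y₁+v))_b) − 1‖²` for `v` near `0` (`c = c₀²∕(‖eV⁻¹‖² + 1)` with `c₀` from §0).
[cite: Helgason2000, Ch. I §1 Thm 1.14 (13) p.96; Balaban1985Averaging, (33)-(34) pp.22-23] -/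
theorem exists_const_sq_norm_le_sum_norm_exp_neg_mul_exp_sub_one_sq (eV : V ≃L[ℝ] (piLogChart C B).lie) :
    ∃ c : ℝ, 0 < c ∧ ∀ y₁ : V, (∀ b : B, ‖((eV y₁ : (piLogChart C B).lie) : B → 𝔸) b‖ ≤ 1 / 2) →
      ∀ᶠ v in 𝓝 (0 : V), c * ‖v‖ ^ 2 ≤ ∑ b : B, ‖exp (-(((eV y₁ : (piLogChart C B).lie) : B → 𝔸) b)) *
        exp (((eV (y₁ + v) : (piLogChart C B).lie) : B → 𝔸) b) - 1‖ ^ 2 := by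
  obtain ⟨c₀, hc₀, hev⟩ := exists_const_norm_sub_le_norm_exp_neg_mul_exp_sub_one (𝔸 := 𝔸) ℝ
  set K : ℝ := ‖(eV.symm : (piLogChart C B).lie →L[ℝ] V)‖ with hK
  have hK0 : 0 ≤ K := norm_nonneg (eV.symm : (piLogChart C B).lie →L[ℝ] V)
  refine ⟨c₀ ^ 2 / (K ^ 2 + 1), by positivity, ?_⟩
  intro y₁ hy₁
  -- componentwise, transported along `v ↦ (eV (y₁ + v))_b`
  have hall : ∀ᶠ v in 𝓝 (0 : V), ∀ b : B,
      c₀ * ‖((eV v : (piLogChart C B).lie) : B → 𝔸) b‖ ≤ ‖exp (-(((eV y₁ : (piLogChart C B).lie) : B → 𝔸) b)) *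
        exp (((eV (y₁ + v) : (piLogChart C B).lie) : B → 𝔸) b) - 1‖ := by
    refine Filter.eventually_all.2 fun b => ?_
    have hcont : Continuous fun v : V => ((eV (y₁ + v) : (piLogChart C B).lie) : B → 𝔸) b :=
      (continuous_apply b).comp (continuous_subtype_val.comp (eV.continuous.comp (continuous_const.add continuous_id)))
    have ht : Tendsto (fun v : V => ((eV (y₁ + v) : (piLogChart C B).lie) : B → 𝔸) b) (𝓝 0)
        (𝓝 (((eV y₁ : (piLogChart C B).lie) : B → 𝔸) b)) := by
      simpa using hcont.tendsto (0 : V)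
    filter_upwards [ht.eventually (hev _ (hy₁ b))] with v hv
    have hdiff : ((eV (y₁ + v) : (piLogChart C B).lie) : B → 𝔸) b - ((eV y₁ : (piLogChart C B).lie) : B → 𝔸) b =
        ((eV v : (piLogChart C B).lie) : B → 𝔸) b := by
      rw [map_add, Submodule.coe_add, Pi.add_apply]; abel
    rwa [hdiff] at hv
  filter_upwards [hall] with v hv
  have hv1 : ‖v‖ ≤ K * ‖(eV v : (piLogChart C B).lie)‖ := by
    have h := (eV.symm : (piLogChart C B).lie →L[ℝ] V).le_opNorm (eV v)
    simpa [hK] using h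
  set Xv : B → 𝔸 := ((eV v : (piLogChart C B).lie) : B → 𝔸) with hXv
  have hsum0 : 0 ≤ ∑ b : B, ‖Xv b‖ ^ 2 := Finset.sum_nonneg fun b _ => sq_nonneg _
  have hX2 : ‖(eV v : (piLogChart C B).lie)‖ ^ 2 ≤ ∑ b : B, ‖Xv b‖ ^ 2 := by
    have hn : ‖(eV v : (piLogChart C B).lie)‖ = ‖Xv‖ := rfl
    rw [hn]
    have hle : ‖Xv‖ ≤ Real.sqrt (∑ b : B, ‖Xv b‖ ^ 2) := by
      refine (pi_norm_le_iff_of_nonneg (Real.sqrt_nonneg _)).2 fun b => ?_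
      refine (Real.le_sqrt (norm_nonneg _) hsum0).2 ?_
      exact Finset.single_le_sum (f := fun b => ‖Xv b‖ ^ 2) (fun b _ => sq_nonneg _) (Finset.mem_univ b)
    calc ‖Xv‖ ^ 2 ≤ (Real.sqrt (∑ b : B, ‖Xv b‖ ^ 2)) ^ 2 := pow_le_pow_left₀ (norm_nonneg _) hle 2
      _ = ∑ b : B, ‖Xv b‖ ^ 2 := Real.sq_sqrt hsum0
  set S := ∑ b : B, ‖exp (-(((eV y₁ : (piLogChart C B).lie) : B → 𝔸) b)) *
    exp (((eV (y₁ + v) : (piLogChart C B).lie) : B → 𝔸) b) - 1‖ ^ 2 with hS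
  have hS0 : 0 ≤ S := Finset.sum_nonneg fun b _ => sq_nonneg _
  have hX3 : c₀ ^ 2 * ∑ b : B, ‖Xv b‖ ^ 2 ≤ S := by
    rw [hS, Finset.mul_sum]
    refine Finset.sum_le_sum fun b _ => ?_
    have hb := hv b
    have h0 : 0 ≤ c₀ * ‖Xv b‖ := by positivity
    calc c₀ ^ 2 * ‖Xv b‖ ^ 2 = (c₀ * ‖Xv b‖) ^ 2 := by ring
      _ ≤ _ := pow_le_pow_left₀ h0 hb 2
  have hv2 : ‖v‖ ^ 2 ≤ K ^ 2 * ∑ b : B, ‖Xv b‖ ^ 2 := by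
    calc ‖v‖ ^ 2 ≤ (K * ‖(eV v : (piLogChart C B).lie)‖) ^ 2 := pow_le_pow_left₀ (norm_nonneg _) hv1 2
      _ = K ^ 2 * ‖(eV v : (piLogChart C B).lie)‖ ^ 2 := by ring
      _ ≤ K ^ 2 * ∑ b : B, ‖Xv b‖ ^ 2 := by gcongr
  rw [div_mul_eq_mul_div, div_le_iff₀ (by positivity)]
  nlinarith [hX3, hv2, hsum0, hS0, sq_nonneg K, sq_nonneg c₀]

end Frame

/-! ## §2  (T2) with the constant relation exposed, and the uniform shifted-base statement -/

variable (F : T3Family) {J K : ℕ} (hJK : J ≤ K)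

/-- **px21 g10's (T2) STEP WITH THE CONSTANT EXPOSED** (✓`…TubularChartDockTransversal.offPivot_transversal_of_rows` re-quantified): for every growth constant
`c > 0` there is `c₁ > 0` (`= c∕(C+1)`, `C` the comb Lipschitz constant of ✓`exists_sum_dist1_coord_le_offPivot` — lattice data only) such that EVERY family
`σ` through EVERY base point `U₀` satisfying (A0) (no comb∕pivot bond moves), (A1) (constant comb transporter) and (A2) with constant `c` leaves the residual orbit of
`U₀` at rate `c₁` in the off-pivot `dist1²`-distance. [cite: Balaban1985Variational, Thm 1 (10) p.279, (19) p.281; Balaban1987RG1, p.256] -/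
theorem offPivot_transversal_of_rows_uniform (hk : K - J ≤ (F.P K).m + (F.P K).K) {Y : Type*} [SeminormedAddCommGroup Y] {c : ℝ} (hc : 0 < c) :
    ∃ c₁ : ℝ, 0 < c₁ ∧ ∀ (σ : Y → GaugeField (F.P K) 0 (Matrix.specialUnitaryGroup (Fin 2) ℂ)) (U₀ : GaugeField (F.P K) 0 (Matrix.specialUnitaryGroup (Fin 2) ℂ)),
      (∀ y, ∀ b ∈ (combSet (K - J) : Set (PBond (F.P K) 0)) ∪ Set.range (iterCentralBond (P := F.P K) (K - J)), σ y b = U₀ b) →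
      (∀ y, combTransporter (K - J) (σ y) = combTransporter (K - J) U₀) →
      (∀ᶠ y in 𝓝 (0 : Y), c * ‖y‖ ^ 2 ≤ ∑ b : PBond (F.P K) 0, dist1 (σ y b * (U₀ b)⁻¹) ^ 2) →
      ∀ᶠ y in 𝓝 (0 : Y),
        c₁ * ‖y‖ ^ 2 ≤ ⨅ w : {w : Site (F.P K) 0 → Matrix.specialUnitaryGroup (Fin 2) ℂ |
              ∀ U : GaugeField (F.P K) 0 (Matrix.specialUnitaryGroup (Fin 2) ℂ),
                descendTo F ℰp J K hJK (GaugeField.gaugeAct w U) = descendTo F ℰp J K hJK U},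
            ∑ ℓ ∈ Finset.univ.filter (fun ℓ : PBond (F.P K) 0 => ∀ c, iterCentralBond (P := F.P K) (K - J) c ≠ ℓ),
              dist1 (σ y ℓ * ((GaugeField.gaugeAct (w : Site (F.P K) 0 → Matrix.specialUnitaryGroup (Fin 2) ℂ) U₀) ℓ)⁻¹) ^ 2 := by
  classical
  obtain ⟨C, hC0, hC⟩ := exists_sum_dist1_coord_le_offPivot (P := F.P K) (n := Fin 2) hk
  refine ⟨c / (C + 1), by positivity, ?_⟩
  intro σ U₀ hσF hσT hev
  haveI : Nonempty {w : Site (F.P K) 0 → Matrix.specialUnitaryGroup (Fin 2) ℂ |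
      ∀ U : GaugeField (F.P K) 0 (Matrix.specialUnitaryGroup (Fin 2) ℂ),
        descendTo F ℰp J K hJK (GaugeField.gaugeAct w U) = descendTo F ℰp J K hJK U} := ⟨⟨1, residual_one F hJK⟩⟩
  filter_upwards [hev] with y hy
  refine le_ciInf fun w => ?_
  obtain ⟨cc, -, hres, hact⟩ := exists_central_isResidual_of_residual F hJK w.2
  set w' : Site (F.P K) 0 → Matrix.specialUnitaryGroup (Fin 2) ℂ := (fun _ => cc⁻¹) * (w : Site (F.P K) 0 → Matrix.specialUnitaryGroup (Fin 2) ℂ)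
    with hw'
  rw [← hact U₀]
  set OFF : Finset (PBond (F.P K) 0) :=
    Finset.univ.filter (fun ℓ : PBond (F.P K) 0 => ∀ c, iterCentralBond (P := F.P K) (K - J) c ≠ ℓ) with hOFF
  set R : ℝ := ∑ ℓ ∈ OFF, dist1 (σ y ℓ * ((GaugeField.gaugeAct w' U₀) ℓ)⁻¹) ^ 2 with hR
  have hR0 : 0 ≤ R := Finset.sum_nonneg fun _ _ => sq_nonneg _
  have h1 : ∑ b : PBond (F.P K) 0, dist1 (σ y b * (U₀ b)⁻¹) ^ 2 = ∑ b ∈ OFF, dist1 (σ y b * (U₀ b)⁻¹) ^ 2 := by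
    have hz : ∑ b ∈ Finset.univ.filter (fun ℓ : PBond (F.P K) 0 => ¬ ∀ c, iterCentralBond (P := F.P K) (K - J) c ≠ ℓ),
        dist1 (σ y b * (U₀ b)⁻¹) ^ 2 = 0 := by
      refine Finset.sum_eq_zero fun b hb => ?_
      rw [Finset.mem_filter] at hb
      obtain ⟨c', hc'⟩ := not_forall_not.1 hb.2
      rw [hσF y b (Or.inr ⟨c', hc'⟩), mul_inv_cancel, GaugeGroup.dist1_one]
      ring
    rw [← Finset.sum_filter_add_sum_filter_not Finset.univ (fun ℓ : PBond (F.P K) 0 => ∀ c, iterCentralBond (P := F.P K) (K - J) c ≠ ℓ),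
      hz, add_zero]
  have h2 : ∀ b : PBond (F.P K) 0, dist1 (σ y b * (U₀ b)⁻¹) =
      dist1 ((combTransporter (K - J) (σ y) b.src * σ y b * (combTransporter (K - J) (σ y) b.tgt)⁻¹) *
        (combTransporter (K - J) (GaugeField.gaugeAct w' U₀) b.src * GaugeField.gaugeAct w' U₀ b *
          (combTransporter (K - J) (GaugeField.gaugeAct w' U₀) b.tgt)⁻¹)⁻¹) := by
    intro b
    rw [coord_gaugeAct_of_rootTrivial (K - J) hres U₀ b, hσT y,
      show combTransporter (K - J) U₀ b.src * σ y b * (combTransporter (K - J) U₀ b.tgt)⁻¹ *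
          (combTransporter (K - J) U₀ b.src * U₀ b * (combTransporter (K - J) U₀ b.tgt)⁻¹)⁻¹ =
        combTransporter (K - J) U₀ b.src * (σ y b * (U₀ b)⁻¹) * (combTransporter (K - J) U₀ b.src)⁻¹ by group,
      GaugeGroup.dist1_conj]
  have h3 : ∑ b ∈ OFF, dist1 (σ y b * (U₀ b)⁻¹) ^ 2 ≤ C * R := by
    rw [Finset.sum_congr rfl fun b _ => by rw [h2 b]]
    exact hC (σ y) (GaugeField.gaugeAct w' U₀)
  have h4 : c * ‖y‖ ^ 2 ≤ C * R := hy.trans (h1.le.trans h3)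
  rw [div_mul_eq_mul_div, div_le_iff₀ (by positivity)]
  nlinarith [h4, hR0, hC0]

/-- ★★ **(T2-SHIFT UNIFORM) — ONE CONSTANT FOR EVERY SHIFTED BASE POINT** (w4-20520 g16's v11.1 shape): over the rows (D0), (D1), (F4a) of the local edition
✓`…TubularChartDockLocal.exists_tubularHaarChart_pivotAct_local`,
`∃ c₁ > 0, ∀ y₁, (∀ b, ‖(eV y₁)_b‖ ≤ 1∕2) → ∀ᶠ v in 𝓝 0, c₁‖v‖² ≤ ⨅_{w residual} Σ_{ℓ ∉ pivots} dist1 (σ (y₁ + v) ℓ · ((w • σ y₁) ℓ)⁻¹)²`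
(the quantifier swap of ✓`…TransversalShift.offPivot_transversal_shift`: §1's uniform constant through (F4a), then `offPivot_transversal_of_rows_uniform`).
[cite: Balaban1985Variational, Thm 1 (10) p.279, (19) p.281; Helgason2000, Ch. I §1 Thm 1.14 (13) p.96] -/
theorem offPivot_transversal_shift_uniform (hk : K - J ≤ (F.P K).m + (F.P K).K)
    [DecidablePred (· ∈ (combSet (K - J) : Set (PBond (F.P K) 0)) ∪ Set.range (iterCentralBond (P := F.P K) (K - J)))] {dV : ℕ}
    {σ : EuclideanSpace ℝ (Fin dV) → GaugeField (F.P K) 0 (Matrix.specialUnitaryGroup (Fin 2) ℂ)}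
    {U₀ : GaugeField (F.P K) 0 (Matrix.specialUnitaryGroup (Fin 2) ℂ)}
    (eV : EuclideanSpace ℝ (Fin dV) ≃L[ℝ] (piLogChart (specialUnitaryLogChart (Fin 2))
      {b : PBond (F.P K) 0 // b ∉ (combSet (K - J) : Set (PBond (F.P K) 0)) ∪ Set.range (iterCentralBond (P := F.P K) (K - J))}).lie)
    (hD0 : ∀ y, ∀ b ∈ (combSet (K - J) : Set (PBond (F.P K) 0)) ∪ Set.range (iterCentralBond (P := F.P K) (K - J)), σ y b = U₀ b)
    (hD1 : ∀ y, combTransporter (K - J) (σ y) = combTransporter (K - J) U₀)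
    (hF4a : ∀ y (b : PBond (F.P K) 0) (hb : b ∉ (combSet (K - J) : Set (PBond (F.P K) 0)) ∪ Set.range (iterCentralBond (P := F.P K) (K - J))),
      σ y b = U₀ b * ((combTransporter (K - J) U₀ b.tgt)⁻¹ *
        (isChartRep_specialUnitaryGroup (n := Fin 2)).expChart
          (lieApply (specialUnitaryLogChart (Fin 2)) {b : PBond (F.P K) 0 // b ∉ (combSet (K - J) : Set (PBond (F.P K) 0)) ∪
            Set.range (iterCentralBond (P := F.P K) (K - J))} (eV y) ⟨b, hb⟩) *
        combTransporter (K - J) U₀ b.tgt)) :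
    ∃ c₁ : ℝ, 0 < c₁ ∧ ∀ y₁ : EuclideanSpace ℝ (Fin dV),
      (∀ b : {b : PBond (F.P K) 0 // b ∉ (combSet (K - J) : Set (PBond (F.P K) 0)) ∪ Set.range (iterCentralBond (P := F.P K) (K - J))},
        ‖((eV y₁ : (piLogChart (specialUnitaryLogChart (Fin 2)) _).lie) : _ → Matrix (Fin 2) (Fin 2) ℂ) b‖ ≤ 1 / 2) →
      ∀ᶠ v in 𝓝 (0 : EuclideanSpace ℝ (Fin dV)),
        c₁ * ‖v‖ ^ 2 ≤ ⨅ w : {w : Site (F.P K) 0 → Matrix.specialUnitaryGroup (Fin 2) ℂ |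
              ∀ U : GaugeField (F.P K) 0 (Matrix.specialUnitaryGroup (Fin 2) ℂ),
                descendTo F ℰp J K hJK (GaugeField.gaugeAct w U) = descendTo F ℰp J K hJK U},
            ∑ ℓ ∈ Finset.univ.filter (fun ℓ : PBond (F.P K) 0 => ∀ c, iterCentralBond (P := F.P K) (K - J) c ≠ ℓ),
              dist1 (σ (y₁ + v) ℓ * ((GaugeField.gaugeAct (w : Site (F.P K) 0 → Matrix.specialUnitaryGroup (Fin 2) ℂ) (σ y₁)) ℓ)⁻¹) ^ 2 := by
  -- the killed bonds (a `let`, NOT a `set`: the statement's `DecidablePred` binder must stay the one instance of record)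
  let F' : Set (PBond (F.P K) 0) := (combSet (K - J) : Set (PBond (F.P K) 0)) ∪ Set.range (iterCentralBond (P := F.P K) (K - J))
  letI : DecidablePred (· ∈ F') :=
    ‹DecidablePred (· ∈ (combSet (K - J) : Set (PBond (F.P K) 0)) ∪ Set.range (iterCentralBond (P := F.P K) (K - J)))›
  set hch := isChartRep_specialUnitaryGroup (n := Fin 2) with hhch
  -- the uniform framed constant, then the uniform (T2) constant
  obtain ⟨c, hc, hev⟩ := exists_const_sq_norm_le_sum_norm_exp_neg_mul_exp_sub_one_sq (specialUnitaryLogChart (Fin 2)) eV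
  obtain ⟨c₁, hc₁, hT2⟩ := offPivot_transversal_of_rows_uniform F hJK hk (Y := EuclideanSpace ℝ (Fin dV)) hc
  refine ⟨c₁, hc₁, fun y₁ hy₁ => ?_⟩
  refine hT2 (fun v => σ (y₁ + v)) (σ y₁) ?_ ?_ ?_
  · intro v b hb
    rw [hD0 (y₁ + v) b hb, hD0 y₁ b hb]
  · intro v
    rw [hD1 (y₁ + v), hD1 y₁]
  · filter_upwards [hev y₁ hy₁] with v hv
    refine hv.trans ?_
    have hterm : ∀ b : {b : PBond (F.P K) 0 // b ∉ F'},
        ‖exp (-(((eV y₁ : (piLogChart (specialUnitaryLogChart (Fin 2)) {b : PBond (F.P K) 0 // b ∉ F'}).lie) :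
            {b : PBond (F.P K) 0 // b ∉ F'} → Matrix (Fin 2) (Fin 2) ℂ) b)) *
          exp (((eV (y₁ + v) : (piLogChart (specialUnitaryLogChart (Fin 2)) {b : PBond (F.P K) 0 // b ∉ F'}).lie) :
            {b : PBond (F.P K) 0 // b ∉ F'} → Matrix (Fin 2) (Fin 2) ℂ) b) - 1‖ ^ 2 =
          dist1 (σ (y₁ + v) b * (σ y₁ b)⁻¹) ^ 2 := by
      intro b
      have e1 := hF4a (y₁ + v) b.1 b.2
      have e0 := hF4a y₁ b.1 b.2
      simp only [Subtype.coe_eta] at e1 e0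
      set X := lieApply (specialUnitaryLogChart (Fin 2)) {b : PBond (F.P K) 0 // b ∉ F'} (eV y₁) b with hX
      set Yv := lieApply (specialUnitaryLogChart (Fin 2)) {b : PBond (F.P K) 0 // b ∉ F'} (eV (y₁ + v)) b with hYv
      set T := combTransporter (K - J) U₀ b.1.tgt with hT
      have h1 : σ (y₁ + v) b * (σ y₁ b)⁻¹ = (U₀ b * T⁻¹) * (hch.expChart Yv * (hch.expChart X)⁻¹) * (U₀ b * T⁻¹)⁻¹ := by
        rw [e1, e0]
        group
      have h2 : dist1 (σ (y₁ + v) b * (σ y₁ b)⁻¹) = dist1 ((hch.expChart X)⁻¹ * hch.expChart Yv) := by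
        rw [h1, GaugeGroup.dist1_conj,
          show (hch.expChart X)⁻¹ * hch.expChart Yv = (hch.expChart X)⁻¹ * (hch.expChart Yv * (hch.expChart X)⁻¹) * (hch.expChart X)⁻¹⁻¹ by group,
          GaugeGroup.dist1_conj]
      rw [h2, ← hch.expChart_neg]
      show _ = ‖(Literature.MathematicalPhysics.QuantumLattice.fundamentalRep (Fin 2)) (hch.expChart (-X) * hch.expChart Yv) - 1‖ ^ 2
      rw [map_mul, hch.rho_expChart, hch.rho_expChart, Submodule.coe_neg, coe_lieApply, coe_lieApply]
    calc ∑ b : {b : PBond (F.P K) 0 // b ∉ F'},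
          ‖exp (-(((eV y₁ : (piLogChart (specialUnitaryLogChart (Fin 2)) {b : PBond (F.P K) 0 // b ∉ F'}).lie) :
              {b : PBond (F.P K) 0 // b ∉ F'} → Matrix (Fin 2) (Fin 2) ℂ) b)) *
            exp (((eV (y₁ + v) : (piLogChart (specialUnitaryLogChart (Fin 2)) {b : PBond (F.P K) 0 // b ∉ F'}).lie) :
              {b : PBond (F.P K) 0 // b ∉ F'} → Matrix (Fin 2) (Fin 2) ℂ) b) - 1‖ ^ 2
        = ∑ b : {b : PBond (F.P K) 0 // b ∉ F'}, dist1 (σ (y₁ + v) b * (σ y₁ b)⁻¹) ^ 2 := Finset.sum_congr rfl fun b _ => hterm b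
      _ = ∑ b ∈ Finset.univ.filter (fun b : PBond (F.P K) 0 => b ∉ F'), dist1 (σ (y₁ + v) b * (σ y₁ b)⁻¹) ^ 2 :=
        (Finset.sum_subtype _ (fun b => by simp) (fun b : PBond (F.P K) 0 => dist1 (σ (y₁ + v) b * (σ y₁ b)⁻¹) ^ 2)).symm
      _ ≤ ∑ b : PBond (F.P K) 0, dist1 (σ (y₁ + v) b * (σ y₁ b)⁻¹) ^ 2 :=
        Finset.sum_le_sum_of_subset_of_nonneg (Finset.filter_subset _ _) fun _ _ _ => sq_nonneg _

end Summit.QuantumFields.YangMills.Theorems.FluctuationComparisonRegPrIntLS2BetaTransversalShiftUniform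

end
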